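import Literature.NumberTheory.LFunctions.SelbergDelangeRieszExpansion
import Literature.NumberTheory.LFunctions.SatheSelbergMeanValue
import HarnessLib

/-!
# One-sided Selberg–Delange for a difference of Riesz means, I: the keyhole of the difference
(crux stmt-Parity-11327, line `jensen-stieltjes-majorant`, stub `stub_rieszDiffEngine`)

Everything here is PROVED (theorems only).  Part of the one-sided Selberg–Delange bound for the
DIFFERENCE of two Riesz means `A₁(x+h) − A₁(x)` of a Dirichlet series `Σ a(n) n^{-s} = ζ(s)^z G(s)`
(data `SelbergDelange.RieszData R (4/5) B z a G` of the tree's contour engine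
`Literature/NumberTheory/LFunctions/SelbergDelangeRieszExpansion.lean`, Montgomery–Vaughan §7.4,
proof of Theorem 7.17): `‖A₁(x+h) − A₁(x)‖ ≤ h·x·(log x)^{Re z−1}·B·e^{c(1+R)^{3/2}}` for
`x e^{−(log log x)³} ≤ h ≤ x`, `1 ≤ R ≤ log log x` — the SIZE of the main term with every constant
explicit in `R`, no main term, no Hankel evaluation, no Taylor expansion at the branch point.

This file: the keyhole integral of `Φ_y − Φ_x = (s−1)^{−z}𝒢(s)(y^{1+s} − x^{1+s})` gains the
factor `(y − x)/x` and is fed to `Keyhole.norm_keyhole_le` with the exponent `p = max(−Re z, 0)`.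

## References

* [MontgomeryVaughan2007] H. L. Montgomery, R. C. Vaughan, *Multiplicative Number Theory I*,
  CUP 2007, §7.4, proof of Theorem 7.17 (pp. 177–178).
* [Tenenbaum2015] G. Tenenbaum, *Introduction to analytic and probabilistic number theory*, 3rd
  ed., AMS GSM 163, II.5 §§5.3–5.4.
-/

noncomputable section

open Complex Set MeasureTheory Filter Topology intervalIntegral Metric
open scoped Real Nat Interval
open Literature.Analysis.Complex Literature.Analysis.Complex.Keyhole
open Literature.NumberTheory.LFunctions Literature.NumberTheory.LFunctions.SelbergDelange

namespace Summit.Parity.BatemanHorn.Cruxes.LinearCappedRepulsion.JensenStieltjesMajorant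

namespace RieszDiff

/-! ### Two elementary estimates -/

/-- **Mean-value bound for `t ↦ t^w`**: for `0 < x ≤ y` and `Re w ≥ 1`,
`‖y^w − x^w‖ ≤ ‖w‖ (y − x) y^{Re w − 1}` (the derivative `w t^{w−1}` has norm `‖w‖ t^{Re w − 1}`,
increasing in `t`). [folklore] -/
theorem norm_cpow_sub_cpow_le {x y : ℝ} (hx : 0 < x) (hxy : x ≤ y) {w : ℂ} (hw : 1 ≤ w.re) :
    ‖(y : ℂ) ^ w - (x : ℂ) ^ w‖ ≤ ‖w‖ * (y - x) * y ^ (w.re - 1) := by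
  have hw0 : w ≠ 0 := by
    intro h0; rw [h0] at hw; simp at hw; linarith
  have hderiv : ∀ t ∈ Icc x y,
      HasDerivWithinAt (fun t : ℝ => (t : ℂ) ^ w) (w * (t : ℂ) ^ (w - 1)) (Icc x y) t := by
    intro t ht
    have ht0 : t ≠ 0 := (hx.trans_le ht.1).ne'
    exact (hasDerivAt_ofReal_cpow_const ht0 hw0).hasDerivWithinAt
  have hbound : ∀ t ∈ Ico x y, ‖w * (t : ℂ) ^ (w - 1)‖ ≤ ‖w‖ * y ^ (w.re - 1) := by
    intro t ht
    have ht0 : 0 < t := hx.trans_le ht.1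
    rw [norm_mul, norm_cpow_eq_rpow_re_of_pos ht0, sub_re, one_re]
    exact mul_le_mul_of_nonneg_left (Real.rpow_le_rpow ht0.le ht.2.le (by linarith))
      (norm_nonneg _)
  have hmv := norm_image_sub_le_of_norm_deriv_le_segment' hderiv hbound y (right_mem_Icc.2 hxy)
  calc ‖(y : ℂ) ^ w - (x : ℂ) ^ w‖ ≤ ‖w‖ * y ^ (w.re - 1) * (y - x) := hmv
    _ = ‖w‖ * (y - x) * y ^ (w.re - 1) := by ring

/-- `max(a, 0) − max(−a, 0) = a`. [folklore] -/
theorem max_zero_sub_max_neg_zero (a : ℝ) : max a 0 - max (-a) 0 = a := by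
  rcases le_or_gt 0 a with h | h
  · rw [max_eq_left h, max_eq_right (by linarith)]; ring
  · rw [max_eq_right h.le, max_eq_left (by linarith)]; ring

/-! ### The keyhole of the difference `Φ_y − Φ_x` -/

/-- **The keyhole integral of the DIFFERENCE of the Riesz–Perron integrands at `y` and `x`**
(`1 < x ≤ y ≤ 2x`, same keyhole `b = 1 − β/log x`, `a = 1 + 1/log x`, `δ = 1/log x`):
`‖keyhole Φ_y − keyhole Φ_x‖ ≤ 13 e^{πR} (2 Cn B) keyholeConst(⌈R⌉) (y − x) x (log x)^{Re z − 1}`.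
Indeed `Φ_y(s) − Φ_x(s) = (s−1)^{−z} 𝒢(s) (y^{1+s} − x^{1+s})` with
`‖y^{1+s} − x^{1+s}‖ ≤ |1+s| (y − x) y^{Re s} ≤ 13 ((y−x)/x) x^{1+Re s}`, `‖𝒢‖ ≤ 2 Cn B` on the keyhole
(`SelbergDelange.norm_smoothPart_le`), `‖(s−1)^{−z}‖ ≤ ‖s−1‖^{−Re z} e^{πR}` and, as `‖s − 1‖ ≥ 1/log x`
there (`SatheSelberg.onKeyhole_norm_sub_one_ge`), `‖s−1‖^{−Re z} ≤ (log x)^{max(Re z,0)} ‖s−1‖^{max(−Re z,0)}`; then `Keyhole.norm_keyhole_le` with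
`p = max(−Re z, 0) ≤ ⌈R⌉`. [cite: MontgomeryVaughan2007, §7.4 p. 178] -/
theorem norm_keyhole_diff_le {R σ₁ B : ℝ} {z : ℂ} {a : ℕ → ℂ} {G : ℂ → ℂ}
    (h : RieszData R σ₁ B z a G) (hσ₁1 : σ₁ < 1) {Cn : ℝ}
    (hCn : ∀ z s : ℂ, ‖z‖ ≤ R → |s.im| ≤ 1 → 1 - zfrWidth 1 / 2 ≤ s.re → s.re ≤ 2 →
      ‖exp (z * logZeta₁ s)‖ ≤ Cn)
    {x y : ℝ} (hx : 1 < x) (hxy : x ≤ y) (hy2 : y ≤ 2 * x) {β : ℝ} (hβ : 1 ≤ β)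
    (hfit : (β + 1) / Real.log x ≤ rho σ₁ / 4) :
    ‖keyhole (integrand z G y) (1 - β / Real.log x) (1 + 1 / Real.log x) (1 / Real.log x) -
        keyhole (integrand z G x) (1 - β / Real.log x) (1 + 1 / Real.log x) (1 / Real.log x)‖ ≤
      13 * Real.exp (π * R) * (Cn * B * 2) * keyholeConst ⌈R⌉₊ * (y - x) * x *
        Real.log x ^ (z.re - 1) := by
  set L : ℝ := Real.log x with hLdef
  have hL : 0 < L := Real.log_pos hx
  have hx0 : 0 < x := by linarith
  have hy0 : 0 < y := by linarith
  have hyx : 0 ≤ y - x := by linarith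
  have hyxx : 0 ≤ (y - x) / x := by positivity
  have hR : 0 ≤ R := (norm_nonneg _).trans h.norm_le
  obtain ⟨hρ, -, hρ4⟩ := rho_pos hσ₁1
  set ρ : ℝ := rho σ₁ with hρdef
  set M : ℝ := Cn * B * 2 with hMdef
  have hB0 : 0 ≤ B := (norm_nonneg _).trans (h.norm_G_le 2 (by simp; linarith))
  have hCn0 : 0 ≤ Cn := (norm_nonneg _).trans (hCn z 2 h.norm_le (by simp)
    (by simp; linarith [zfrWidth_pos 1]) (by simp))
  have hM0 : 0 ≤ M := by positivity
  -- keyhole points: in the slit plane, close to `1`, at distance `≥ 1/L`, in the ball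
  have hkey : ∀ s, onKeyhole (1 - β / L) (1 + 1 / L) (1 / L) s →
      s - 1 ∈ slitPlane ∧ ‖s - 1‖ ≤ ρ / 4 ∧ 1 / L ≤ ‖s - 1‖ ∧ s ∈ ball (1 : ℂ) ρ := by
    intro s hs
    obtain ⟨h1, h2⟩ := onKeyhole_mem hL hβ hs
    refine ⟨h1, h2.trans hfit, SatheSelberg.onKeyhole_norm_sub_one_ge hL hs, ?_⟩
    rw [mem_ball, dist_eq_norm]; linarith [h2.trans hfit]
  -- the difference integrand
  set D : ℂ → ℂ := fun s ↦ (s - 1) ^ (-z) * smoothPart z G s *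
    ((y : ℂ) ^ (1 + s) - (x : ℂ) ^ (1 + s)) with hDdef
  have hdiff𝒢 := differentiableOn_smoothPart h hσ₁1
  have hM𝒢 : ∀ s ∈ ball (1 : ℂ) ρ, ‖smoothPart z G s‖ ≤ M := fun s hs ↦
    norm_smoothPart_le h hσ₁1 hCn hs
  -- continuity at keyhole points
  have hc𝒢 : ∀ s, onKeyhole (1 - β / L) (1 + 1 / L) (1 / L) s → ContinuousAt (smoothPart z G) s :=
    fun s hs ↦ (hdiff𝒢.differentiableAt (isOpen_ball.mem_nhds (hkey s hs).2.2.2)).continuousAt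
  have hcΦ : ∀ t : ℝ, 0 < t → ∀ s, onKeyhole (1 - β / L) (1 + 1 / L) (1 / L) s →
      ContinuousAt (integrand z G t) s := by
    intro t ht s hs
    have e : integrand z G t = fun s ↦ smoothPart z G s * ((s - 1) ^ (-z) * (t : ℂ) ^ (1 + s)) := by
      funext s; rw [integrand_eq]; ring
    rw [e]
    exact (hc𝒢 s hs).mul (continuousAt_monomial ht z (hkey s hs).1)
  have hcD : ∀ s, onKeyhole (1 - β / L) (1 + 1 / L) (1 / L) s → ContinuousAt D s := by
    intro s hs
    have e : D = fun s ↦ integrand z G y s + (-1) * integrand z G x s := by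
      funext s; simp only [hDdef, integrand_eq]; ring
    rw [e]
    exact (hcΦ y hy0 s hs).add (continuousAt_const.mul (hcΦ x hx0 s hs))
  -- `keyhole Φ_y − keyhole Φ_x = keyhole D`
  have hsplit : keyhole (integrand z G y) (1 - β / L) (1 + 1 / L) (1 / L) -
      keyhole (integrand z G x) (1 - β / L) (1 + 1 / L) (1 / L) =
        keyhole D (1 - β / L) (1 + 1 / L) (1 / L) := by
    have e : integrand z G y = fun s ↦ D s + integrand z G x s := by
      funext s; simp only [hDdef, integrand_eq]; ring
    rw [e, keyhole_add hcD (hcΦ x hx0)]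
    ring
  rw [hsplit]
  -- the exponent of `norm_keyhole_le`
  set p : ℝ := max (-z.re) 0 with hpdef
  have hp0 : 0 ≤ p := le_max_right _ _
  have hpn : p ≤ ((⌈R⌉₊ : ℕ) : ℝ) := by
    have h1 : -z.re ≤ R := by
      linarith [neg_abs_le z.re, (abs_re_le_norm z).trans h.norm_le]
    exact (max_le h1 hR).trans (Nat.le_ceil R)
  set A : ℝ := 13 * Real.exp (π * R) * M * ((y - x) / x) * L ^ (max z.re 0) with hAdef
  have hA0 : 0 ≤ A := by positivity
  -- the pointwise bound on the keyhole
  have hbd : ∀ s, onKeyhole (1 - β / L) (1 + 1 / L) (1 / L) s →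
      ‖D s‖ ≤ A * ‖s - 1‖ ^ p * x ^ (1 + s.re) := by
    intro s hs
    obtain ⟨hslit, hsρ, hsL, hsball⟩ := hkey s hs
    have hs1 : s - 1 ≠ 0 := slitPlane_ne_zero hslit
    have hsmall : ‖s - 1‖ ≤ 1 / 16 := by linarith
    have hre_s : |s.re - 1| ≤ 1 / 16 := by
      have := abs_re_le_norm (s - 1); rw [sub_re, one_re] at this; exact this.trans hsmall
    have hre1 : s.re ≤ 1 + 1 / 16 := by linarith [(abs_le.1 hre_s).2]
    have hre2 : 1 - 1 / 16 ≤ s.re := by linarith [(abs_le.1 hre_s).1]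
    -- factor 1: the principal power
    have h1 : ‖(s - 1) ^ (-z)‖ ≤ L ^ (max z.re 0) * ‖s - 1‖ ^ p * Real.exp (π * R) := by
      have hc := SelbergDelange.norm_cpow_neg_le hs1 z
      have hexp := exp_pi_mul_abs_im_le h.norm_le
      have hpow : ‖s - 1‖ ^ (-z.re) ≤ L ^ (max z.re 0) * ‖s - 1‖ ^ p := by
        rcases le_or_gt z.re 0 with hz0 | hz0
        · have e1 : max z.re 0 = 0 := max_eq_right hz0
          have e2 : p = -z.re := by rw [hpdef]; exact max_eq_left (by linarith)
          rw [e1, e2, Real.rpow_zero, one_mul]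
        · have e1 : max z.re 0 = z.re := max_eq_left hz0.le
          have e2 : p = 0 := by rw [hpdef]; exact max_eq_right (by linarith)
          rw [e1, e2, Real.rpow_zero, mul_one]
          calc ‖s - 1‖ ^ (-z.re) ≤ (1 / L) ^ (-z.re) :=
                Real.rpow_le_rpow_of_nonpos (by positivity) hsL (by linarith)
            _ = L ^ z.re := by
                rw [one_div, Real.inv_rpow hL.le, Real.rpow_neg hL.le, inv_inv]
      calc ‖(s - 1) ^ (-z)‖ ≤ ‖s - 1‖ ^ (-z.re) * Real.exp (π * |z.im|) := hc
        _ ≤ (L ^ (max z.re 0) * ‖s - 1‖ ^ p) * Real.exp (π * R) :=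
            mul_le_mul hpow hexp (Real.exp_pos _).le (by positivity)
        _ = _ := by ring
    -- factor 2: the smooth part
    have h2 : ‖smoothPart z G s‖ ≤ M := hM𝒢 s hsball
    -- factor 3: the difference of powers
    have h3 : ‖(y : ℂ) ^ (1 + s) - (x : ℂ) ^ (1 + s)‖ ≤ 13 * ((y - x) / x) * x ^ (1 + s.re) := by
      have hw : 1 ≤ (1 + s).re := by simp; linarith
      have hmv := norm_cpow_sub_cpow_le hx0 hxy hw
      have hn1s : ‖1 + s‖ ≤ 3 := by
        calc ‖1 + s‖ = ‖(s - 1) + 2‖ := by ring_nf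
          _ ≤ ‖s - 1‖ + ‖(2 : ℂ)‖ := norm_add_le _ _
          _ ≤ 1 / 16 + 2 := by rw [Complex.norm_two]; linarith
          _ ≤ 3 := by norm_num
      have hre' : (1 + s).re - 1 = s.re := by simp
      rw [hre'] at hmv
      have hypow : y ^ s.re ≤ 4 * x ^ s.re := by
        calc y ^ s.re ≤ (2 * x) ^ s.re := Real.rpow_le_rpow hy0.le hy2 (by linarith)
          _ = 2 ^ s.re * x ^ s.re := Real.mul_rpow (by norm_num) hx0.le
          _ ≤ 4 * x ^ s.re := by
              refine mul_le_mul_of_nonneg_right ?_ (by positivity)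
              calc (2 : ℝ) ^ s.re ≤ 2 ^ (2 : ℝ) :=
                    Real.rpow_le_rpow_of_exponent_le (by norm_num) (by linarith)
                _ = 4 := by norm_num
      have hxpow : x ^ (1 + s.re) = x * x ^ s.re := by rw [Real.rpow_add hx0, Real.rpow_one]
      calc ‖(y : ℂ) ^ (1 + s) - (x : ℂ) ^ (1 + s)‖ ≤ ‖1 + s‖ * (y - x) * y ^ s.re := hmv
        _ ≤ 3 * (y - x) * (4 * x ^ s.re) :=
            mul_le_mul (mul_le_mul_of_nonneg_right hn1s hyx) hypow (by positivity) (by positivity)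
        _ = 12 * ((y - x) / x) * x ^ (1 + s.re) := by rw [hxpow]; field_simp; ring
        _ ≤ 13 * ((y - x) / x) * x ^ (1 + s.re) := by
            refine mul_le_mul_of_nonneg_right (mul_le_mul_of_nonneg_right (by norm_num) hyxx) ?_
            positivity
    -- together
    calc ‖D s‖ = ‖(s - 1) ^ (-z)‖ * ‖smoothPart z G s‖ *
          ‖(y : ℂ) ^ (1 + s) - (x : ℂ) ^ (1 + s)‖ := by simp only [hDdef, norm_mul]
      _ ≤ (L ^ (max z.re 0) * ‖s - 1‖ ^ p * Real.exp (π * R)) * M *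
            (13 * ((y - x) / x) * x ^ (1 + s.re)) :=
          mul_le_mul (mul_le_mul h1 h2 (norm_nonneg _) (by positivity)) h3 (norm_nonneg _)
            (by positivity)
      _ = A * ‖s - 1‖ ^ p * x ^ (1 + s.re) := by rw [hAdef]; ring
  -- the keyhole bound
  have hK := norm_keyhole_le hx hβ hA0 hp0 hpn hbd
  refine hK.trans (le_of_eq ?_)
  -- bookkeeping of the exponents: `L^{max(Re z,0)} · L^{−p−1} = L^{Re z − 1}`
  have hexp : L ^ (max z.re 0) * L ^ (-p - 1) = L ^ (z.re - 1) := by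
    rw [← Real.rpow_add hL]
    congr 1
    rw [hpdef]
    linarith [max_zero_sub_max_neg_zero z.re]
  calc A * keyholeConst ⌈R⌉₊ * x ^ 2 * L ^ (-p - 1)
      = 13 * Real.exp (π * R) * M * keyholeConst ⌈R⌉₊ * (y - x) * x *
          (L ^ (max z.re 0) * L ^ (-p - 1)) := by
        rw [hAdef]; field_simp
    _ = 13 * Real.exp (π * R) * (Cn * B * 2) * keyholeConst ⌈R⌉₊ * (y - x) * x *
          L ^ (z.re - 1) := by rw [hexp, hMdef]

end RieszDiff

/-- **Registered sub-goal `stub_rieszDiffKeyhole` of crux stmt-Parity-11327** (part of `stub_rieszDiffEngine`):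
the keyhole of the difference (`RieszDiff.norm_keyhole_diff_le`, ∀-closed). [cite: MontgomeryVaughan2007, §7.4 pp. 177–178] -/
theorem stub_rieszDiffKeyhole :
      ∀ (R σ₁ B : ℝ) (z : ℂ) (a : ℕ → ℂ) (G : ℂ → ℂ), SelbergDelange.RieszData R σ₁ B z a G → σ₁ < 1
      → ∀ Cn : ℝ, (∀ w s : ℂ, ‖w‖ ≤ R → |s.im| ≤ 1 → 1 - zfrWidth 1 / 2 ≤ s.re → s.re ≤ 2 →
      ‖Complex.exp (w * logZeta₁ s)‖ ≤ Cn) → ∀ x y : ℝ, 1 < x → x ≤ y → y ≤ 2 * x → ∀ β : ℝ, 1 ≤ β →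
      (β + 1) / Real.log x ≤ SelbergDelange.rho σ₁ / 4 → ‖Keyhole.keyhole (SelbergDelange.integrand
      z G y) (1 - β / Real.log x) (1 + 1 / Real.log x) (1 / Real.log x) - Keyhole.keyhole
      (SelbergDelange.integrand z G x) (1 - β / Real.log x) (1 + 1 / Real.log x) (1 / Real.log x)‖ ≤
      13 * Real.exp (Real.pi * R) * (Cn * B * 2) * Keyhole.keyholeConst ⌈R⌉₊ * (y - x) * x *
      Real.log x ^ (z.re - 1) :=
  fun _ _ _ _ _ _ h hσ₁1 _ hCn _ _ hx hxy hy2 _ hβ hfit =>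
    RieszDiff.norm_keyhole_diff_le h hσ₁1 hCn hx hxy hy2 hβ hfit

end Summit.Parity.BatemanHorn.Cruxes.LinearCappedRepulsion.JensenStieltjesMajorant
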